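import Summits.AtomisticToContinuum.BoseEinsteinCondensation.Theorems.BECStronglyRayleighLatticeToPeriodicBridgeCoarseCellDefs
import Summits.AtomisticToContinuum.BoseEinsteinCondensation.Theorems.BECStronglyRayleighLatticeToPeriodicBridgeCellPoincare
import Summits.AtomisticToContinuum.BoseEinsteinCondensation.Theorems.BECStronglyRayleighLatticeToPeriodicBridgeCellPairSplit
import Literature.MathematicalPhysics.QuantumManyBody.CondensateOccupationStability
import HarnessLib

/-!
# Cell norm retention (stub `stub_cellNormRetention` of line `coarse-cell-lorentzian`)

Route `BECStronglyRayleigh`, crux `LatticeToPeriodicBridge` (stmt-AtomisticToContinuum-9674),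
line `coarse-cell-lorentzian`, registered stub S2 `Sig.stub_cellNormRetention` of the line's
`Defs` module (`…CoarseCellDefs`), proved here as `stub_cellNormRetention` (exact signature, by
name). Third of three files: the generic inputs are `…CellPoincare` (Neumann–Poincaré on
translated cubes, variance form on cube pairs, the cube tiling of `[0,L)³`) and `…CellPairSplit`
(calculus and Fubini for the tagged pair `(ξ, η, X') = Fin.cons ξ (Fin.cons η X')`, which is the
line's `pairConfig ξ η X'` by `rfl`, and the Bose symmetry of the kinetic energy).

**Statement.** For a real-valued periodic trial state `Ψ` of `N'+2` bosons on the torus of side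
`L`, any potential `v` with `E = periodicEnergy v Ψ < ∞`, and `M ≥ 1` cells per side (`b = L/M`):
`b⁶ (1 − 2b² E/(N'+2)) ≤ I_K = kernelMass L M Ψ = ∫_{cell^{N'}} Σ_{x,y} K_{X'}(x,y)² dX'`,
`K_{X'}(x,y) = ∫_{C_x}∫_{C_y} Re Ψ(ξ, η, X')` (`cellKernel`).

**Proof.** Fix the background `X'` and a cell pair `C_x × C_y` (a cube pair of side `b`); with
`g = Re Ψ(·, ·, X')`, `K = ∫_{C_x×C_y} g` (Fubini, `cellKernel_eq_setIntegral_prod`) and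
`∫ g² − K²/b⁶ = ∫ |g − ḡ|² ≤ (b/π)² ∫ |∇_{ξ,η} g|² ≤ b² ∫ (∑ₖ|∂_{0,k}Ψ|² + ∑ₖ|∂_{1,k}Ψ|²)`
(`sq_integral_le_of_contDiff`, `gradSq_re_finCons_le`, `π ≥ 1`; `sq_setIntegral_le_cellKernel`).
Summing over the `M⁶` pairs, which tile `cell²` (`iUnion_prod_cubeIco_corner`,
`setIntegral_cell_prod_eq_sum`, from the cube tiling of `…CellPoincare`), gives the bound
at fixed `X'` (`setIntegral_sq_le_sum_cellKernel`); integrating over `X' ∈ cell^{N'}` (the three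
background functions are integrable: `X' ↦ Σ K²` is continuous, `continuous_cellKernel`, by
`continuous_parametric_integral_of_continuous` on the closed cubes, a null modification) and
reading `∫_{X'}∫_{cell²}` as `∫_{cell^{N'+2}}` (`integral_cellN_eq_integral_pair`):
`1 = ∫|Ψ|² ≤ I_K/b⁶ + b² T₀₁` with `T₀₁ = 2T/(N'+2) ≤ 2E/(N'+2)` the kinetic energy of particles
`0, 1` (`lintegral_kineticDensity_eq_mul`, `T = ∫ kineticDensity ≤ E`;
`integral_integral_kinPart_le`), i.e. `one_le_kernelMass_div_add`; multiply by `b⁶`.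
Reality enters only through `(Re Ψ)² = |Ψ|²` (`re_sq_eq_norm_sq`). No case distinction on the sign
of the bracket is needed. Helpers live in the sub-namespace `….CellNormRetention`.

References: LSSY2005 (E. H. Lieb, R. Seiringer, J. P. Solovej, J. Yngvason, *The Mathematics of the
Bose Gas and its Condensation*, 2005), after (2.50) (Neumann gap of a cube) and §1.2 (1.16);
L. E. Payne, H. F. Weinberger, Arch. Rational Mech. Anal. 5 (1960) 286–292 (Poincaré constant of
convex domains); O. Penrose, L. Onsager, Phys. Rev. 104 (1956) 576 (coarse-grained kernels).
-/

noncomputable section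

open MeasureTheory Filter Metric Set
open scoped ENNReal Topology NNReal Real

namespace Summit.AtomisticToContinuum.BoseEinsteinCondensation.Cruxes.LatticeToPeriodicBridge.CoarseCellLorentzian

namespace CellNormRetention

open Literature.MathematicalPhysics.QuantumManyBody.BoseGas
open Literature.MathematicalPhysics.QuantumManyBody.BoseGas.Poincare

/-! ## The `M⁶` cell pairs tile `cell L × cell L` -/

section TilingPairs

variable {M : ℕ} {L : ℝ}

/-- **The `M⁶` cube pairs tile `[0,L)³ × [0,L)³`.** [folklore] -/
theorem iUnion_prod_cubeIco_corner (hL : 0 < L) (hM : 1 ≤ M) :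
    ⋃ xy : (Fin 3 → Fin M) × (Fin 3 → Fin M),
        cubeIco (corner M (L / M) xy.1) (L / M) ×ˢ cubeIco (corner M (L / M) xy.2) (L / M) =
      cell L ×ˢ cell L := by
  exact (iUnion_prod (fun x : Fin 3 → Fin M => cubeIco (corner M (L / M) x) (L / M))
    (fun y : Fin 3 → Fin M => cubeIco (corner M (L / M) y) (L / M))).trans
      (by rw [iUnion_cubeIco_corner hL hM])

/-- Distinct cube pairs are disjoint. [folklore] -/
theorem pairwise_disjoint_prod_cubeIco_corner {b : ℝ} (hb : 0 < b) :
    Pairwise (Function.onFun Disjoint fun xy : (Fin 3 → Fin M) × (Fin 3 → Fin M) =>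
      cubeIco (corner M b xy.1) b ×ˢ cubeIco (corner M b xy.2) b) := by
  intro p q hpq
  rw [Function.onFun, Set.disjoint_prod]
  by_cases h1 : p.1 = q.1
  · exact Or.inr (pairwise_disjoint_cubeIco_corner hb fun h2 => hpq (Prod.ext h1 h2))
  · exact Or.inl (pairwise_disjoint_cubeIco_corner hb h1)

/-- **Splitting an integral over `[0,L)³ × [0,L)³` into the `M⁶` cube pairs** (`M ≥ 1`).
[folklore] -/
theorem setIntegral_cell_prod_eq_sum (hL : 0 < L) (hM : 1 ≤ M) {f : Space × Space → ℝ}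
    (hf : IntegrableOn f (cell L ×ˢ cell L) volume) :
    ∫ p in cell L ×ˢ cell L, f p = ∑ x : Fin 3 → Fin M, ∑ y : Fin 3 → Fin M,
      ∫ p in cubeIco (corner M (L / M) x) (L / M) ×ˢ cubeIco (corner M (L / M) y) (L / M),
        f p := by
  have hMpos : (0 : ℝ) < M := by exact_mod_cast hM
  have hb : 0 < L / M := div_pos hL hMpos
  have hint : ∀ xy : (Fin 3 → Fin M) × (Fin 3 → Fin M), IntegrableOn f
      (cubeIco (corner M (L / M) xy.1) (L / M) ×ˢ cubeIco (corner M (L / M) xy.2) (L / M))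
      volume := fun xy =>
    hf.mono_set (Set.prod_mono (cubeIco_corner_subset_cell hL hM xy.1)
      (cubeIco_corner_subset_cell hL hM xy.2))
  have hmeas : ∀ xy : (Fin 3 → Fin M) × (Fin 3 → Fin M), MeasurableSet
      (cubeIco (corner M (L / M) xy.1) (L / M) ×ˢ cubeIco (corner M (L / M) xy.2) (L / M)) :=
    fun xy => (measurableSet_cubeIco _ _).prod (measurableSet_cubeIco _ _)
  rw [← iUnion_prod_cubeIco_corner hL hM, integral_iUnion_fintype hmeas
    (pairwise_disjoint_prod_cubeIco_corner hb) hint, Fintype.sum_prod_type]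

end TilingPairs

/-! ## One cell pair: the kernel entry is a mean, and the variance bound -/

section CellPair

variable {N' M : ℕ} {L : ℝ}

/-- `torusCell M b x` (the line's cell with integer label `x`) is the half-open cube of side `b`
with corner `b·x`. [folklore] -/
theorem torusCell_eq_cubeIco (M : ℕ) (b : ℝ) (x : Fin 3 → Fin M) :
    torusCell M b x = cubeIco (corner M b x) b := by
  ext ξ
  simp only [torusCell, cubeIco, corner, mem_setOf_eq, add_mul, one_mul]

/-- **The kernel entry is the integral of `Re Ψ(·, ·, X')` over the cell pair** (Fubini):
`K_{X'}(x,y) = ∫_{C_x × C_y} Re Ψ(ξ, η, X') d(ξ, η)`. [folklore] -/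
theorem cellKernel_eq_setIntegral_prod {Ψ : Config (N' + 2) → ℂ} (hΨ : Continuous Ψ) (L : ℝ)
    (M : ℕ) (X' : Config N') (x y : Fin 3 → Fin M) :
    cellKernel L M Ψ X' x y =
      ∫ p in cubeIco (corner M (L / M) x) (L / M) ×ˢ cubeIco (corner M (L / M) y) (L / M),
        (Ψ (Fin.cons p.1 (Fin.cons p.2 X'))).re := by
  have hc : Continuous fun p : Space × Space => (Ψ (Fin.cons p.1 (Fin.cons p.2 X'))).re :=
    Complex.continuous_re.comp (hΨ.comp (continuous_finCons_finCons_left X'))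
  have hi : IntegrableOn (fun p : Space × Space => (Ψ (Fin.cons p.1 (Fin.cons p.2 X'))).re)
      (cubeIco (corner M (L / M) x) (L / M) ×ˢ cubeIco (corner M (L / M) y) (L / M))
      (volume.prod volume) := by
    rw [← Measure.volume_eq_prod]
    exact integrableOn_prod_cubeIco hc _ _ _
  unfold cellKernel pairConfig
  rw [torusCell_eq_cubeIco, torusCell_eq_cubeIco, Measure.volume_eq_prod, setIntegral_prod _ hi]

/-- **Variance bound on one cell pair**: for `Ψ ∈ C¹` and every background `X'`,
`∫_{C_x×C_y} (Re Ψ)² ≤ K_{X'}(x,y)² / b⁶ + b² ∫_{C_x×C_y} (∑ₖ|∂_{0,k}Ψ|² + ∑ₖ|∂_{1,k}Ψ|²)`,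
`b = L/M`: the squared mean plus the Neumann–Poincaré bound on the variance, with
`(b/π)² ≤ b²` and `|∇ Re Ψ(·,·,X')|² ≤` the kinetic density of particles `0, 1`. [folklore] -/
theorem sq_setIntegral_le_cellKernel {Ψ : Config (N' + 2) → ℂ} (hΨ : ContDiff ℝ 1 Ψ)
    (hL : 0 < L) (hM : 1 ≤ M) (X' : Config N') (x y : Fin 3 → Fin M) :
    ∫ p in cubeIco (corner M (L / M) x) (L / M) ×ˢ cubeIco (corner M (L / M) y) (L / M),
        (Ψ (Fin.cons p.1 (Fin.cons p.2 X'))).re ^ 2 ≤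
      cellKernel L M Ψ X' x y ^ 2 / (L / M) ^ 6 + (L / M) ^ 2 *
        ∫ p in cubeIco (corner M (L / M) x) (L / M) ×ˢ cubeIco (corner M (L / M) y) (L / M),
          (kinPart 0 Ψ (Fin.cons p.1 (Fin.cons p.2 X')) +
            kinPart 1 Ψ (Fin.cons p.1 (Fin.cons p.2 X'))) := by
  have hMpos : (0 : ℝ) < M := by exact_mod_cast hM
  have hb : 0 < L / M := div_pos hL hMpos
  have hΨd := hΨ.differentiable one_ne_zero
  have h1 := sq_integral_le_of_contDiff (contDiff_re_finCons hΨ X') (corner M (L / M) x)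
    (corner M (L / M) y) hb
  rw [← cellKernel_eq_setIntegral_prod hΨ.continuous] at h1
  refine h1.trans (add_le_add le_rfl ?_)
  -- `(b/π)² ∫ |∇G|² ≤ b² ∫ kin₀₁`
  have hDc : Continuous fun p : Space × Space =>
      (∑ k, fderiv ℝ (fun q : Space × Space => (Ψ (Fin.cons q.1 (Fin.cons q.2 X'))).re) p
          (EuclideanSpace.single k 1, 0) ^ 2) +
        ∑ k, fderiv ℝ (fun q : Space × Space => (Ψ (Fin.cons q.1 (Fin.cons q.2 X'))).re) p
          (0, EuclideanSpace.single k 1) ^ 2 := by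
    have hc := (contDiff_re_finCons hΨ X').continuous_fderiv one_ne_zero
    fun_prop
  have hKc : Continuous fun p : Space × Space =>
      kinPart 0 Ψ (Fin.cons p.1 (Fin.cons p.2 X')) + kinPart 1 Ψ (Fin.cons p.1 (Fin.cons p.2 X')) :=
    ((continuous_kinPart 0 hΨ).add (continuous_kinPart 1 hΨ)).comp
      (continuous_finCons_finCons_left X')
  have hle := setIntegral_mono (integrableOn_prod_cubeIco hDc (corner M (L / M) x)
    (corner M (L / M) y) (L / M)) (integrableOn_prod_cubeIco hKc _ _ _)
    fun p => gradSq_re_finCons_le hΨd X' p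
  have hnn : 0 ≤ ∫ p in cubeIco (corner M (L / M) x) (L / M) ×ˢ cubeIco (corner M (L / M) y) (L / M),
      (kinPart 0 Ψ (Fin.cons p.1 (Fin.cons p.2 X')) + kinPart 1 Ψ (Fin.cons p.1 (Fin.cons p.2 X'))) :=
    integral_nonneg fun p => add_nonneg (kinPart_nonneg _ _ _) (kinPart_nonneg _ _ _)
  have hπ : (L / M / π) ^ 2 ≤ (L / M) ^ 2 := by
    rw [div_pow]
    exact div_le_self (sq_nonneg _) (one_le_pow₀ (by linarith [Real.two_le_pi]))
  calc (L / M / π) ^ 2 * _ ≤ (L / M / π) ^ 2 * _ := mul_le_mul_of_nonneg_left hle (sq_nonneg _)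
    _ ≤ (L / M) ^ 2 * _ := mul_le_mul_of_nonneg_right hπ hnn

/-- **Cell norm retention at fixed background** (summing the variance bound over the `M⁶` cell
pairs, which tile `[0,L)³ × [0,L)³`): `∫_{cell²} (Re Ψ(·,·,X'))² ≤ (Σ_{x,y} K_{X'}(x,y)²)/b⁶ +
b² ∫_{cell²} (∑ₖ|∂_{0,k}Ψ|² + ∑ₖ|∂_{1,k}Ψ|²)(·,·,X')`. [folklore] -/
theorem setIntegral_sq_le_sum_cellKernel {Ψ : Config (N' + 2) → ℂ} (hΨ : ContDiff ℝ 1 Ψ)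
    (hL : 0 < L) (hM : 1 ≤ M) (X' : Config N') :
    ∫ p in cell L ×ˢ cell L, (Ψ (Fin.cons p.1 (Fin.cons p.2 X'))).re ^ 2 ≤
      (∑ x : Fin 3 → Fin M, ∑ y : Fin 3 → Fin M, cellKernel L M Ψ X' x y ^ 2) / (L / M) ^ 6 +
        (L / M) ^ 2 * ∫ p in cell L ×ˢ cell L,
          (kinPart 0 Ψ (Fin.cons p.1 (Fin.cons p.2 X')) +
            kinPart 1 Ψ (Fin.cons p.1 (Fin.cons p.2 X'))) := by
  have hGc : Continuous fun p : Space × Space => (Ψ (Fin.cons p.1 (Fin.cons p.2 X'))).re ^ 2 :=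
    (Complex.continuous_re.comp (hΨ.continuous.comp (continuous_finCons_finCons_left X'))).pow 2
  have hKc : Continuous fun p : Space × Space =>
      kinPart 0 Ψ (Fin.cons p.1 (Fin.cons p.2 X')) + kinPart 1 Ψ (Fin.cons p.1 (Fin.cons p.2 X')) :=
    ((continuous_kinPart 0 hΨ).add (continuous_kinPart 1 hΨ)).comp
      (continuous_finCons_finCons_left X')
  have hint : ∀ {f : Space × Space → ℝ}, Continuous f →
      IntegrableOn f (cell L ×ˢ cell L) volume :=
    fun hf => by rw [cell_eq_cubeIco]; exact integrableOn_prod_cubeIco hf _ _ _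
  rw [setIntegral_cell_prod_eq_sum hL hM (hint hGc), setIntegral_cell_prod_eq_sum hL hM (hint hKc),
    Finset.sum_div, Finset.mul_sum, ← Finset.sum_add_distrib]
  refine Finset.sum_le_sum fun x _ => ?_
  rw [Finset.sum_div, Finset.mul_sum, ← Finset.sum_add_distrib]
  exact Finset.sum_le_sum fun y _ => sq_setIntegral_le_cellKernel hΨ hL hM X' x y

end CellPair

/-! ## Integrating over the background `X'` -/

section Background

variable {N' M : ℕ} {L : ℝ}

/-- **The kernel entries depend continuously on the background** `X'` (parametric integrals of a
continuous function over compact cubes; the half-open cells are replaced by their closures, a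
null modification). [folklore] -/
theorem continuous_cellKernel {Ψ : Config (N' + 2) → ℂ} (hΨ : Continuous Ψ) (L : ℝ) (M : ℕ)
    (x y : Fin 3 → Fin M) : Continuous fun X' : Config N' => cellKernel L M Ψ X' x y := by
  have hcl : ∀ z : Fin 3 → Fin M, (volume : Measure Space).restrict (torusCell M (L / M) z) =
      volume.restrict (cubeIcc (corner M (L / M) z) (L / M)) := fun z => by
    rw [torusCell_eq_cubeIco]
    exact Measure.restrict_congr_set (cubeIco_ae_eq_cubeIcc _ _)
  have hj : Continuous fun r : (Config N' × Space) × Space =>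
      (Ψ (Fin.cons r.1.2 (Fin.cons r.2 r.1.1))).re :=
    Complex.continuous_re.comp (hΨ.comp (continuous_finCons_finCons.comp
      (by fun_prop : Continuous fun r : (Config N' × Space) × Space => (r.1.1, (r.1.2, r.2)))))
  have h1 : Continuous fun q : Config N' × Space =>
      ∫ η in cubeIcc (corner M (L / M) y) (L / M), (Ψ (Fin.cons q.2 (Fin.cons η q.1))).re :=
    continuous_parametric_integral_of_continuous
      (f := fun (q : Config N' × Space) (η : Space) => (Ψ (Fin.cons q.2 (Fin.cons η q.1))).re)
      hj (isCompact_cubeIcc _ _)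
  have h2 : Continuous fun X' : Config N' => ∫ ξ in cubeIcc (corner M (L / M) x) (L / M),
      ∫ η in cubeIcc (corner M (L / M) y) (L / M), (Ψ (Fin.cons ξ (Fin.cons η X'))).re :=
    continuous_parametric_integral_of_continuous
      (f := fun (X' : Config N') (ξ : Space) =>
        ∫ η in cubeIcc (corner M (L / M) y) (L / M), (Ψ (Fin.cons ξ (Fin.cons η X'))).re) h1
      (isCompact_cubeIcc _ _)
  have h3 : (fun X' : Config N' => cellKernel L M Ψ X' x y) = fun X' : Config N' =>
      ∫ ξ in cubeIcc (corner M (L / M) x) (L / M),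
        ∫ η in cubeIcc (corner M (L / M) y) (L / M), (Ψ (Fin.cons ξ (Fin.cons η X'))).re := by
    funext X'
    unfold cellKernel pairConfig
    rw [hcl x, hcl y]
  rw [h3]
  exact h2

/-- For a real-valued state, `(Re Ψ)² = |Ψ|²`. [folklore] -/
theorem re_sq_eq_norm_sq {z : ℂ} (hz : z.im = 0) : z.re ^ 2 = ‖z‖ ^ 2 := by
  rw [Complex.sq_norm, Complex.normSq_apply, hz]; ring

/-- **Normalisation, read through the tagged pair**: for a real normalised state,
`∫_{X'} ∫_{cell²} (Re Ψ(ξ,η,X'))² = 1`. [folklore] -/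
theorem integral_integral_re_sq_eq_one (Ψ : PeriodicTrialState (N' + 2) L)
    (hreal : ∀ X, (Ψ.ψ X).im = 0) :
    ∫ X' in cellN N' L, ∫ p, (Ψ.ψ (Fin.cons p.1 (Fin.cons p.2 X'))).re ^ 2
        ∂(((volume : Measure Space).restrict (cell L)).prod
          ((volume : Measure Space).restrict (cell L))) = 1 := by
  have hc : Continuous fun X => (Ψ.ψ X).re ^ 2 :=
    (Complex.continuous_re.comp Ψ.contDiff.continuous).pow 2
  rw [← integral_cellN_eq_integral_pair (h := fun X => (Ψ.ψ X).re ^ 2) hc]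
  simp_rw [re_sq_eq_norm_sq (hreal _)]
  have h := lintegral_cellN_nnnorm_sq_eq_ofReal L Ψ.contDiff.continuous
  rw [Ψ.norm_eq] at h
  exact ENNReal.ofReal_eq_one.1 h.symm

/-- **The kinetic energy of the tagged pair is `2/(N'+2)` of the total** (Bose symmetry), and the
total is at most the energy: for a periodic trial state of `N'+2` bosons with finite energy,
`∫_{X'} ∫_{cell²} (∑ₖ|∂_{0,k}Ψ|² + ∑ₖ|∂_{1,k}Ψ|²)(ξ,η,X') ≤ 2 E(Ψ)/(N'+2)`. [folklore] -/
theorem integral_integral_kinPart_le (v : ℝ → ℝ≥0∞) (Ψ : PeriodicTrialState (N' + 2) L)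
    (hE : periodicEnergy v Ψ ≠ ⊤) :
    ∫ X' in cellN N' L, ∫ p, (kinPart 0 Ψ.ψ (Fin.cons p.1 (Fin.cons p.2 X')) +
        kinPart 1 Ψ.ψ (Fin.cons p.1 (Fin.cons p.2 X')))
        ∂(((volume : Measure Space).restrict (cell L)).prod
          ((volume : Measure Space).restrict (cell L))) ≤
      2 * (periodicEnergy v Ψ).toReal / ((N' : ℝ) + 2) := by
  have hΨ := Ψ.contDiff
  have hc : Continuous fun X => kinPart 0 Ψ.ψ X + kinPart 1 Ψ.ψ X :=
    (continuous_kinPart 0 hΨ).add (continuous_kinPart 1 hΨ)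
  rw [← integral_cellN_eq_integral_pair (h := fun X => kinPart 0 Ψ.ψ X + kinPart 1 Ψ.ψ X) hc]
  -- the per-particle kinetic energy `P₀` and the total `T = (N'+2) P₀ ≤ E`
  set P0 : ℝ≥0∞ := ∫⁻ X in cellN (N' + 2) L, kinPartE 0 Ψ.ψ X with hP0
  have hT : ∫⁻ X in cellN (N' + 2) L, kineticDensity Ψ.ψ X = ((N' + 1 + 1 : ℕ) : ℝ≥0∞) * P0 :=
    lintegral_kineticDensity_eq_mul (n := N' + 1) L hΨ Ψ.symm
  have hTE : ∫⁻ X in cellN (N' + 2) L, kineticDensity Ψ.ψ X ≤ periodicEnergy v Ψ :=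
    lintegral_mono fun X => le_self_add
  have hP0E : ((N' : ℝ) + 2) * P0.toReal ≤ (periodicEnergy v Ψ).toReal := by
    have h := ENNReal.toReal_mono hE (hT.symm.le.trans hTE)
    rw [ENNReal.toReal_mul, ENNReal.toReal_natCast] at h
    have hc : ((N' + 1 + 1 : ℕ) : ℝ) = (N' : ℝ) + 2 := by push_cast; ring
    rwa [hc] at h
  -- the real pair kinetic energy is `2 P₀`
  have h01 : ∫ X in cellN (N' + 2) L, (kinPart 0 Ψ.ψ X + kinPart 1 Ψ.ψ X) = (2 * P0).toReal := by
    rw [integral_eq_lintegral_of_nonneg_ae (Eventually.of_forall fun X =>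
      add_nonneg (kinPart_nonneg _ _ _) (kinPart_nonneg _ _ _)) hc.aestronglyMeasurable]
    congr 1
    have hsplit : ∀ X, ENNReal.ofReal (kinPart 0 Ψ.ψ X + kinPart 1 Ψ.ψ X) =
        kinPartE 0 Ψ.ψ X + kinPartE 1 Ψ.ψ X := fun X => by
      rw [ENNReal.ofReal_add (kinPart_nonneg _ _ _) (kinPart_nonneg _ _ _), kinPartE_eq_ofReal,
        kinPartE_eq_ofReal]
    simp_rw [hsplit]
    rw [lintegral_add_left (measurable_kinPartE 0 hΨ), setLIntegral_kinPartE_eq L hΨ Ψ.symm 1,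
      two_mul]
  rw [h01, ENNReal.toReal_mul, ENNReal.toReal_ofNat]
  have hN : (0 : ℝ) < (N' : ℝ) + 2 := by positivity
  rw [le_div_iff₀ hN]
  nlinarith [hP0E, ENNReal.toReal_nonneg (a := P0)]

/-- **Cell norm retention, integrated form** (all `M ≥ 1`): for a real periodic trial state of
`N'+2` bosons with finite energy and `b = L/M`, `1 ≤ I_K / b⁶ + b² · 2E(Ψ)/(N'+2)`. [folklore] -/
theorem one_le_kernelMass_div_add (v : ℝ → ℝ≥0∞) (hL : 0 < L) (hM : 1 ≤ M)
    (Ψ : PeriodicTrialState (N' + 2) L) (hreal : ∀ X, (Ψ.ψ X).im = 0)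
    (hE : periodicEnergy v Ψ ≠ ⊤) :
    1 ≤ kernelMass L M Ψ.ψ / (L / M) ^ 6 +
      (L / M) ^ 2 * (2 * (periodicEnergy v Ψ).toReal / ((N' : ℝ) + 2)) := by
  have hΨ := Ψ.contDiff
  have hΨc := hΨ.continuous
  set μ2 : Measure (Space × Space) := ((volume : Measure Space).restrict (cell L)).prod
    ((volume : Measure Space).restrict (cell L)) with hμ2
  have hμ2' : μ2 = volume.restrict (cell L ×ˢ cell L) := by
    rw [hμ2, Measure.prod_restrict, ← Measure.volume_eq_prod]
  -- the three background functions
  set F : Config N' → ℝ := fun X' =>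
    ∫ p, (Ψ.ψ (Fin.cons p.1 (Fin.cons p.2 X'))).re ^ 2 ∂μ2 with hF
  set S : Config N' → ℝ := fun X' => ∑ x : Fin 3 → Fin M, ∑ y : Fin 3 → Fin M,
    cellKernel L M Ψ.ψ X' x y ^ 2 with hS
  set K : Config N' → ℝ := fun X' => ∫ p, (kinPart 0 Ψ.ψ (Fin.cons p.1 (Fin.cons p.2 X')) +
    kinPart 1 Ψ.ψ (Fin.cons p.1 (Fin.cons p.2 X'))) ∂μ2 with hK
  have hFi : Integrable F ((volume : Measure (Config N')).restrict (cellN N' L)) :=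
    integrableOn_integral_pair (h := fun X => (Ψ.ψ X).re ^ 2)
      ((Complex.continuous_re.comp hΨc).pow 2) L
  have hKi : Integrable K ((volume : Measure (Config N')).restrict (cellN N' L)) :=
    integrableOn_integral_pair (h := fun X => kinPart 0 Ψ.ψ X + kinPart 1 Ψ.ψ X)
      ((continuous_kinPart 0 hΨ).add (continuous_kinPart 1 hΨ)) L
  have hSc : Continuous S := by
    refine continuous_finsetSum _ fun x _ => continuous_finsetSum _ fun y _ => ?_
    exact (continuous_cellKernel hΨc L M x y).pow 2
  have hSi : Integrable S ((volume : Measure (Config N')).restrict (cellN N' L)) :=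
    integrableOn_cellN hSc L
  -- pointwise in `X'`
  have hpt : ∀ X', F X' ≤ S X' / (L / M) ^ 6 + (L / M) ^ 2 * K X' := fun X' => by
    simp only [hF, hS, hK, hμ2']
    exact setIntegral_sq_le_sum_cellKernel hΨ hL hM X'
  -- integrate
  have hint : ∫ X' in cellN N' L, F X' ≤
      ∫ X' in cellN N' L, (S X' / (L / M) ^ 6 + (L / M) ^ 2 * K X') :=
    integral_mono hFi ((hSi.div_const _).add (hKi.const_mul _)) hpt
  rw [integral_add (hSi.div_const _) (hKi.const_mul _), integral_div, integral_const_mul] at hint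
  have h1 : ∫ X' in cellN N' L, F X' = 1 := integral_integral_re_sq_eq_one Ψ hreal
  have h2 : ∫ X' in cellN N' L, K X' ≤ 2 * (periodicEnergy v Ψ).toReal / ((N' : ℝ) + 2) :=
    integral_integral_kinPart_le v Ψ hE
  have hKM : kernelMass L M Ψ.ψ = ∫ X' in cellN N' L, S X' := rfl
  rw [h1] at hint
  rw [hKM]
  exact hint.trans (add_le_add le_rfl (mul_le_mul_of_nonneg_left h2 (sq_nonneg _)))

end Background

end CellNormRetention

/-! ## The registered stub -/

open Literature.MathematicalPhysics.QuantumManyBody.BoseGas CellNormRetention in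
/-- **S2 — cell norm retention.** For a real-valued periodic trial state `Ψ` of `N'+2` bosons on
the torus of side `L` with finite energy, cut into `M³` cells of side `b = L/M` (`M ≥ 1`), the
background-integrated Frobenius mass of the conditional cell-pair kernels retains almost all of
the `L²` norm: `b⁶ (1 − 2b² E(Ψ)/(N'+2)) ≤ I_K`. Proof: on each cell pair `C_x × C_y` (a
translate of `(0,b)⁶` up to a null set), `∫ g² − b⁻⁶(∫ g)² = ∫ |g − ḡ|² ≤ (b/π)² ∫ |∇_{ξ,η} g|²`
for `g = Re Ψ(·,·,X')` by the Neumann gap of the cube (`isPoincare_space`, transported by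
translation and tensorised); summing over the `M⁶` pairs, which tile `cell²`, and integrating
over the background `X' ∈ cell^{N'}` (Fubini along `cell^{N'+2} ≅ cell^{N'} × cell²`) gives
`1 ≤ I_K/b⁶ + b² T₀₁`, where the kinetic energy `T₀₁` of particles `0, 1` is `2T/(N'+2) ≤ 2E/(N'+2)`
by Bose symmetry. Any potential `v` (the interaction is only dropped); the sharp constant of
Payne–Weinberger is not needed (`π⁻² ≤ 1`). [folklore] -/
theorem stub_cellNormRetention : Sig.stub_cellNormRetention := by
  intro v N' L M hL hM Ψ hreal hE
  have hMpos : (0 : ℝ) < M := by exact_mod_cast hM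
  have hb : 0 < L / M := div_pos hL hMpos
  have hb6 : 0 < (L / M) ^ 6 := pow_pos hb 6
  have key := one_le_kernelMass_div_add v hL hM Ψ hreal hE
  rw [div_add' _ _ _ hb6.ne', le_div_iff₀ hb6, one_mul] at key
  have hid : (L / M) ^ 6 * (1 - 2 * (L / M) ^ 2 * (periodicEnergy v Ψ).toReal / ((N' : ℝ) + 2)) =
      (L / M) ^ 6 - (L / M) ^ 2 * (2 * (periodicEnergy v Ψ).toReal / ((N' : ℝ) + 2)) *
        (L / M) ^ 6 := by ring
  rw [hid]
  linarith

end Summit.AtomisticToContinuum.BoseEinsteinCondensation.Cruxes.LatticeToPeriodicBridge.CoarseCellLorentzian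

end
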